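import Mathlib
import HarnessLib
import Literature.Computability.AlgebraicComplexity.AlmanLi2026SpectrumMatMul
import Summits.MatrixMultiplication.MatrixMultiplication.Theorems.OutsiderSandwichBlockOne
import Summits.MatrixMultiplication.MatrixMultiplication.Theorems.OutsiderSandwichCouplingBenchmark
import Summits.MatrixMultiplication.MatrixMultiplication.Theorems.OutsiderSandwichEdgeRigidity
import Summits.MatrixMultiplication.MatrixMultiplication.Theorems.OutsiderSandwichGluingGain

/-!
# Outsider sandwich — the ROTATION BUDGET of the gluing gain and the normal form of the minimal
# counterexample to `BlockOneIsMM` (decomp-mm lens-4, g21, part 2/3)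

Continues `OutsiderSandwichGluingGain` (`gain F = log₂ F(C₁) − θ₀ − θ₂`, `logRatio F = θ₁ − gain F`,
leaf at `F` ⟺ `θ₁ ≤ gain F`).  `F_C := rotatePoint F` (`OutsiderSandwichBlockOne`), `C₃ = C₁` rotated,
`C₂ = C₁` rotated twice; the spectrum is rotation-closed and `τ_{F_C} = τ_F`.

1. **ROTATION BUDGET** — the proved coupling benchmark `4·F⟨2,2,2⟩² ≤ F(C) = F(C₁)F(C₂)F(C₃)`
   (`OutsiderSandwichCouplingBenchmark.couplingBenchmark_holds`) read in exchange currency: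
   **`logRatio F + logRatio F_C + logRatio F_{CC} ≤ τ_F − 2`** at every universal point
   (`logRatio_rotation_budget`; the three pointwise bounds `logRatio ≤ τ_F − 2` only give `3(τ_F − 2)`),
   equivalently **`gain F + gain F_C + gain F_{CC} ≥ 2`** (`two_le_sum_gain`): the three gluing gains of
   an orbit pay for two full letters.  Hence every rotation orbit contains a point with
   `logRatio ≤ (τ_F − 2)/3 ≤ (ω − 2)/3` (`exists_rotation_logRatio_le[_omega]`), a rotation-symmetric
   point has `logRatio F ≤ (τ_F − 2)/3`, a counterexample forces `logRatio F_C + logRatio F_{CC} <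
   τ_F − 2 − logRatio F` on its own orbit, and at a maximiser `F⋆` of `logRatio` (part 3):
   `logRatio F⋆_C + logRatio F⋆_{CC} ≤ τ⋆ − 2 − θ⋆`.
2. **`θ₁(F) = 1 ⟹ F(C₁) = F⟨2,2,2⟩ = 4`** (gain ≤ 1 plus edge rigidity) and `τ_F > 2 ⟹ θᵢ(F) < 1`.
3. **NORMAL FORM** (`counterexample_normalForm`): a universal `F` with `F(C₁) < F⟨2,2,2⟩` has
   `2 < τ_F ≤ ω`, all `θᵢ(F) < 1`, `max(0, θ₁ − 1/2) ≤ gain F < θ₁(F)`, `4 ≤ F(C₁) < 2^{τ_F}`, and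
   `logRatio F_C + logRatio F_{CC} < τ_F − 2`.

[CoppersmithWinograd1990, §6]; [Strassen1988, Thm. 3.8]; [AlmanLi2026, Prop. 4.1–4.2].
-/

noncomputable section

open Literature.Computability.AlgebraicComplexity
open Summit.MatrixMultiplication.MatrixMultiplication.Theorems.OutsiderSandwichCoupling
  (coupling₁ coupling₂ coupling₃ couplingTensor)
open Summit.MatrixMultiplication.MatrixMultiplication.Theorems.OutsiderSandwichBlockOne
  (rotatePoint rotatePoint_apply isUniversal_rotatePoint map_rotate_matMulTensor rotatePoint_matMul
    map_coupling₂ map_coupling₃)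
open Summit.MatrixMultiplication.MatrixMultiplication.Theorems.OutsiderSandwichEdgeRigidity
  (four_le_map_matMulTensor_two sides_lt_two_of_two_lt_matExp)
open Summit.MatrixMultiplication.MatrixMultiplication.Theorems.OutsiderSandwichBlock
  (map_matMulTensor_pos)
open Summit.MatrixMultiplication.MatrixMultiplication.Theorems.OutsiderSandwichExchangeExponent
  (exchangeExponent)
open Summit.MatrixMultiplication.MatrixMultiplication.Theorems.OutsiderSandwichExchangeSpectral
open Summit.MatrixMultiplication.MatrixMultiplication.Theorems.OutsiderSandwichGluingGain

namespace Summit.MatrixMultiplication.MatrixMultiplication.Theorems.OutsiderSandwichGluingBudget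

variable {F : SpectralMap ℂ}

/-! ## 1. Rotations: the three gains and the benchmark budget -/

/-- Letters of the rotated point: `θ₀(F_C) = θ₂(F)`. [cite: AlmanLi2026, Prop. 4.1] -/
theorem specMMPoint_rotatePoint_zero (hF : IsUniversalSpectralPoint ℂ F) :
    specMMPoint ℂ (rotatePoint F) 0 = specMMPoint ℂ F 2 := by
  simp only [specMMPoint_zero, specMMPoint_two, rotatePoint_apply, map_rotate_matMulTensor hF]

/-- `θ₁(F_C) = θ₀(F)`. [cite: AlmanLi2026, Prop. 4.1] -/
theorem specMMPoint_rotatePoint_one (hF : IsUniversalSpectralPoint ℂ F) :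
    specMMPoint ℂ (rotatePoint F) 1 = specMMPoint ℂ F 0 := by
  simp only [specMMPoint_zero, specMMPoint_one, rotatePoint_apply, map_rotate_matMulTensor hF]

/-- `θ₂(F_C) = θ₁(F)`. [cite: AlmanLi2026, Prop. 4.1] -/
theorem specMMPoint_rotatePoint_two (hF : IsUniversalSpectralPoint ℂ F) :
    specMMPoint ℂ (rotatePoint F) 2 = specMMPoint ℂ F 1 := by
  simp only [specMMPoint_one, specMMPoint_two, rotatePoint_apply, map_rotate_matMulTensor hF]

/-- `F(C₁) F(C₂) F(C₃) = F(C₁) · F_{CC}(C₁) · F_C(C₁)` and the benchmark: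
**`4 F⟨2,2,2⟩² ≤ F(C₁) · F_{CC}(C₁) · F_C(C₁)`**. [cite: CoppersmithWinograd1990, §6] -/
theorem benchmark_rotations (hF : IsUniversalSpectralPoint ℂ F) :
    4 * F (matMulTensor ℂ 2 2 2) ^ 2 ≤
      F coupling₁ * rotatePoint (rotatePoint F) coupling₁ * rotatePoint F coupling₁ := by
  have h := OutsiderSandwichCouplingBenchmark.couplingBenchmark_holds F hF
  rw [show couplingTensor = kroneckerTensor (kroneckerTensor coupling₁ coupling₂) coupling₃ from rfl,
    hF.map_kronecker, hF.map_kronecker, map_coupling₂ F, map_coupling₃ F] at h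
  exact h

/-- **ROTATION BUDGET: `logRatio F + logRatio F_C + logRatio F_{CC} ≤ τ_F − 2`** at every universal
point — the coupling benchmark in exchange currency (the separate bounds give only `3(τ_F − 2)`).
[cite: CoppersmithWinograd1990, §6] -/
theorem logRatio_rotation_budget (hF : IsUniversalSpectralPoint ℂ F) :
    logRatio F + logRatio (rotatePoint F) + logRatio (rotatePoint (rotatePoint F)) ≤
      Real.logb 2 (F (matMulTensor ℂ 2 2 2)) - 2 := by
  have hC := isUniversal_rotatePoint hF
  have hCC := isUniversal_rotatePoint hC
  have hM := map_matMulTensor_pos hF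
  have h₁ := map_coupling₁_pos hF
  have h₂ := map_coupling₁_pos hCC
  have h₃ := map_coupling₁_pos hC
  have hB := benchmark_rotations hF
  have hlog := Real.logb_le_logb_of_le one_lt_two (by positivity) hB
  rw [Real.logb_mul (by norm_num) (pow_pos hM 2).ne', Real.logb_pow,
    Real.logb_mul (mul_pos h₁ h₂).ne' h₃.ne', Real.logb_mul h₁.ne' h₂.ne'] at hlog
  have h4 : Real.logb 2 (4 : ℝ) = 2 := by
    rw [show (4 : ℝ) = 2 ^ (2 : ℕ) by norm_num, Real.logb_pow, Real.logb_self_eq_one one_lt_two]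
    norm_num
  rw [logRatio_eq_logb_sub hF, logRatio_eq_logb_sub hC, logRatio_eq_logb_sub hCC,
    rotatePoint_matMul hC, rotatePoint_matMul hF]
  push_cast at hlog
  linarith

/-- **`gain F + gain F_C + gain F_{CC} ≥ 2`** (the budget in gain form: the three gluing gains of a
rotation orbit pay for two full letters). [cite: CoppersmithWinograd1990, §6] -/
theorem two_le_sum_gain (hF : IsUniversalSpectralPoint ℂ F) :
    2 ≤ gain F + gain (rotatePoint F) + gain (rotatePoint (rotatePoint F)) := by
  have hC := isUniversal_rotatePoint hF
  have hCC := isUniversal_rotatePoint hC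
  have h := logRatio_rotation_budget hF
  rw [logRatio_eq hF, logRatio_eq hC, logRatio_eq hCC, specMMPoint_rotatePoint_one hC,
    specMMPoint_rotatePoint_one hF, specMMPoint_rotatePoint_zero hF, logb_map_matMul_eq hF] at h
  linarith

/-- **Every rotation orbit has a good member**: `min_k logRatio F_{C^k} ≤ (τ_F − 2)/3`.
[cite: CoppersmithWinograd1990, §6] -/
theorem exists_rotation_logRatio_le (hF : IsUniversalSpectralPoint ℂ F) :
    min (logRatio F) (min (logRatio (rotatePoint F)) (logRatio (rotatePoint (rotatePoint F)))) ≤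
      (Real.logb 2 (F (matMulTensor ℂ 2 2 2)) - 2) / 3 := by
  have h := logRatio_rotation_budget hF
  have m₁ := min_le_left (logRatio F)
    (min (logRatio (rotatePoint F)) (logRatio (rotatePoint (rotatePoint F))))
  have m₂ := (min_le_right (logRatio F) _).trans
    (min_le_left (logRatio (rotatePoint F)) (logRatio (rotatePoint (rotatePoint F))))
  have m₃ := (min_le_right (logRatio F) _).trans
    (min_le_right (logRatio (rotatePoint F)) (logRatio (rotatePoint (rotatePoint F))))
  linarith

/-- … and `(τ_F − 2)/3 ≤ (ω − 2)/3` (`≤ 0.1244` by the tree's `ω ≤ 2.37295`): **no orbit is bad in all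
three rotations by more than a third of the laser slack**. [cite: AlmanLi2026, Prop. 4.2] -/
theorem exists_rotation_logRatio_le_omega (hF : IsUniversalSpectralPoint ℂ F) :
    min (logRatio F) (min (logRatio (rotatePoint F)) (logRatio (rotatePoint (rotatePoint F)))) ≤
      (omega ℂ - 2) / 3 := by
  have h := exists_rotation_logRatio_le hF
  have hω : Real.logb 2 (F (matMulTensor ℂ 2 2 2)) ≤ omega ℂ := by
    rw [logb_map_matMul_eq hF, ← Fin.sum_univ_three]
    exact AlmanLi2026.prop42_sum_le_omega hF
  linarith

/-- **Rotation-symmetric points are nearly harmless: `F_C = F ⟹ logRatio F ≤ (τ_F − 2)/3`.**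
[cite: CoppersmithWinograd1990, §6] -/
theorem logRatio_le_of_rotatePoint_eq (hF : IsUniversalSpectralPoint ℂ F) (hsym : rotatePoint F = F) :
    logRatio F ≤ (Real.logb 2 (F (matMulTensor ℂ 2 2 2)) - 2) / 3 := by
  have h := logRatio_rotation_budget hF
  rw [hsym, hsym] at h
  linarith

/-- **A counterexample constrains its own orbit**: `F(C₁) < F⟨2,2,2⟩ ⟹
logRatio F_C + logRatio F_{CC} < τ_F − 2 − logRatio F < τ_F − 2`. [cite: CoppersmithWinograd1990, §6] -/
theorem rotations_of_counterexample (hF : IsUniversalSpectralPoint ℂ F)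
    (hviol : F coupling₁ < F (matMulTensor ℂ 2 2 2)) :
    0 < logRatio F ∧
      logRatio (rotatePoint F) + logRatio (rotatePoint (rotatePoint F)) <
        Real.logb 2 (F (matMulTensor ℂ 2 2 2)) - 2 := by
  have hpos : 0 < logRatio F := by
    rw [logRatio]
    exact Real.logb_pos one_lt_two ((one_lt_div (map_coupling₁_pos hF)).2 hviol)
  have h := logRatio_rotation_budget hF
  exact ⟨hpos, by linarith⟩

/-- **The budget at the extremal point**: `logRatio F⋆_C + logRatio F⋆_{CC} ≤ τ_{F⋆} − 2 − θ⋆`.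
[cite: CoppersmithWinograd1990, §6] -/
theorem rotations_of_extremal (hF : IsUniversalSpectralPoint ℂ F) (hFe : logRatio F = exchangeExponent) :
    logRatio (rotatePoint F) + logRatio (rotatePoint (rotatePoint F)) ≤
      Real.logb 2 (F (matMulTensor ℂ 2 2 2)) - 2 - exchangeExponent := by
  have h := logRatio_rotation_budget hF
  rw [hFe] at h
  linarith

/-! ## 2. Maximal letters -/

/-- **`θ₁(F) = 1 ⟹ F(C₁) = F⟨2,2,2⟩ = 4`**: where the middle letter is maximal the two one-block
statements hold with equality (`gain ≤ 1 = θ₁` and edge rigidity `τ_F = 2`). [cite: AlmanLi2026, Prop. 4.2] -/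
theorem map_coupling₁_eq_of_letter_one (hF : IsUniversalSpectralPoint ℂ F) (h1 : specMMPoint ℂ F 1 = 1) :
    F coupling₁ = F (matMulTensor ℂ 2 2 2) ∧ F (matMulTensor ℂ 2 2 2) = 4 := by
  have hside : F (matMulTensor ℂ 1 2 1) = 2 := by
    have e : Real.logb 2 (F (matMulTensor ℂ 1 2 1)) = 1 := by rw [← specMMPoint_one]; exact h1
    have hpos : 0 < F (matMulTensor ℂ 1 2 1) :=
      lt_of_lt_of_le one_pos (hF.one_le_map_matMulTensor le_rfl (by norm_num) le_rfl)
    have := Real.rpow_logb two_pos (by norm_num) hpos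
    rw [e, Real.rpow_one] at this
    exact this.symm
  have h4 : F (matMulTensor ℂ 2 2 2) = 4 :=
    OutsiderSandwichEdgeRigidity.map_matMulTensor_two_eq_four_of_side hF (Or.inr (Or.inl hside))
  refine ⟨le_antisymm ?_ ?_, h4⟩
  · rw [ge_iff_gain_le hF, h1]
    exact gain_le_one hF
  · rw [h4]
    exact four_le_map_coupling₁ hF

/-! ## 3. Normal form of the minimal counterexample -/

/-- `θᵢ(F) < 1` for all `i` once `τ_F > 2` (edge rigidity: a maximal letter forces `τ_F = 2`).
[cite: AlmanLi2026, Prop. 4.2] -/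
theorem letters_lt_one_of_two_lt (hF : IsUniversalSpectralPoint ℂ F)
    (hτ : 2 < Real.logb 2 (F (matMulTensor ℂ 2 2 2))) (i : Fin 3) : specMMPoint ℂ F i < 1 := by
  obtain ⟨h₀, h₁, h₂⟩ := sides_lt_two_of_two_lt_matExp hF hτ
  have key : ∀ {x : ℝ}, 1 ≤ x → x < 2 → Real.logb 2 x < 1 := by
    intro x h1 h2
    calc Real.logb 2 x < Real.logb 2 2 := Real.logb_lt_logb one_lt_two (by linarith) h2
      _ = 1 := Real.logb_self_eq_one one_lt_two
  fin_cases i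
  · simpa using key (hF.one_le_map_matMulTensor (by norm_num) le_rfl le_rfl) h₀
  · simpa using key (hF.one_le_map_matMulTensor le_rfl (by norm_num) le_rfl) h₁
  · simpa using key (hF.one_le_map_matMulTensor le_rfl le_rfl (by norm_num)) h₂

/-- **NORMAL FORM OF A COUNTEREXAMPLE TO THE LEAF.**  A universal `F` with `F(C₁) < F⟨2,2,2⟩` has:
(a) `2 < τ_F ≤ ω`; (b) every letter `θᵢ(F) < 1`; (c) `0 ≤ gain F`, `θ₁(F) − 1/2 ≤ gain F` and
`gain F < θ₁(F)`; (d) `4 ≤ F(C₁) < 2^{τ_F}`; (e) on its orbit `logRatio F_C + logRatio F_{CC} < τ_F − 2`.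
[cite: Strassen1988, Thm. 3.8] -/
theorem counterexample_normalForm (hF : IsUniversalSpectralPoint ℂ F)
    (hviol : F coupling₁ < F (matMulTensor ℂ 2 2 2)) :
    (2 < Real.logb 2 (F (matMulTensor ℂ 2 2 2)) ∧ Real.logb 2 (F (matMulTensor ℂ 2 2 2)) ≤ omega ℂ) ∧
      (∀ i, specMMPoint ℂ F i < 1) ∧
      (0 ≤ gain F ∧ specMMPoint ℂ F 1 - 1 / 2 ≤ gain F ∧ gain F < specMMPoint ℂ F 1) ∧
      ((4 : ℝ) ≤ F coupling₁ ∧ F coupling₁ < (2 : ℝ) ^ Real.logb 2 (F (matMulTensor ℂ 2 2 2))) ∧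
      logRatio (rotatePoint F) + logRatio (rotatePoint (rotatePoint F)) <
        Real.logb 2 (F (matMulTensor ℂ 2 2 2)) - 2 := by
  have hC4 := four_le_map_coupling₁ hF
  have hlogC : 2 ≤ Real.logb 2 (F coupling₁) := by
    have := two_sub_le_gain hF
    rw [logb_map_coupling₁_eq]
    linarith
  have hlt : Real.logb 2 (F coupling₁) < Real.logb 2 (F (matMulTensor ℂ 2 2 2)) :=
    Real.logb_lt_logb one_lt_two (map_coupling₁_pos hF) hviol
  have hτ : 2 < Real.logb 2 (F (matMulTensor ℂ 2 2 2)) := lt_of_le_of_lt hlogC hlt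
  have hω : Real.logb 2 (F (matMulTensor ℂ 2 2 2)) ≤ omega ℂ := by
    rw [logb_map_matMul_eq hF, ← Fin.sum_univ_three]
    exact AlmanLi2026.prop42_sum_le_omega hF
  have hgainlt : gain F < specMMPoint ℂ F 1 := by
    have h := (le_iff_le_gain hF).not.1 (not_le.2 hviol)
    exact lt_of_not_ge h
  refine ⟨⟨hτ, hω⟩, letters_lt_one_of_two_lt hF hτ, ⟨gain_nonneg hF, sub_half_le_gain hF, hgainlt⟩,
    ⟨hC4, ?_⟩, (rotations_of_counterexample hF hviol).2⟩
  rw [Real.rpow_logb two_pos (by norm_num) (map_matMulTensor_pos hF)]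
  exact hviol

end Summit.MatrixMultiplication.MatrixMultiplication.Theorems.OutsiderSandwichGluingBudget

end
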